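import Literature.Geometry.Symplectic.TaubesCurve
import Literature.Geometry.Symplectic.CanonicalClass
import Literature.Geometry.Symplectic.SymplecticHomologicalOrientation
import HarnessLib

/-!
# Taubes' `SW ⇒ Gr`: the canonical class of a closed symplectic `4`-manifold is represented by a
# symplectic curve — sign-free form, `b⁺ ≥ 2` (Taubes 1995) and `b⁺ = 1` (Li–Liu) (named facts)

Topic `Literature/Geometry/Symplectic`.  TWO named facts, no proofs.

For a closed connected symplectic `4`-manifold `(N, s)` with its symplectic `ℤ`-orientation `μ`
(`μ.IsSymplecticOrientationOf s`, `SymplecticHomologicalOrientation.lean`):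

* (C₂) if `b⁺(N) ≥ 2` there is an `s`-compatible almost complex structure `J` and a Taubes curve
  (`HasTaubesCurve`, `TaubesCurve.lean`: an embedded closed symplectic surface, possibly
  disconnected, with the adjunction bookkeeping) in the class `K`, where `K` is the canonical
  class `K_J` OR `c₁(TN, J) = −K_J` — Taubes 1995, Thm. A (1) (with §3 (3.2) and Prop. 4.2;
  Taubes 1994 Main Theorem; Taubes 1996, where Thm. 4.1 and Prop. 4.2 of Taubes 1995 are proved;
  McDuff–Salamon 2017 Thm. 13.3.10, Cor. 13.3.23);
* (C₁) the same conclusion when `b⁺(N) = 1`, `b₁(N) ≥ 1` and the rational cup product on `H¹`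
  vanishes — the wall-crossing number of every Spinᶜ structure then vanishes (Li–Liu 1995,
  general wall-crossing formula: Thm. 1.2, Cor. 1.3 and the remark after Cor. 1.6, p. 799), so
  Taubes's `SW(K⁻¹) = ±1` (Taubes 1994; for `b⁺ = 1` in Taubes's chamber: Li–Liu 1995, ruled
  surfaces, §0 p. 454) and charge conjugation give `SW(K) = ±1` in Taubes's chamber, and
  `SW ⇒ Gr` for `b⁺ = 1` (Li–Liu 1999, Main Theorem; Taubes 1996) represents `K` by a symplectic
  curve — the deduction is printed in Liu 1996, proof of Lemma 8 (p. 575); McDuff–Salamon 2017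
  Thm. 13.3.10 (`b⁺ = 1` clause), Rem. 13.3.7 eq. (13.3.7) with eq. (13.3.2), Rem. 13.3.8,
  Thm. 13.3.22, Cor. 13.3.23 (Cor. 13.3.24 (ii) there is the `b⁺ > 1` statement).  The `b⁺ = 1`
  links are restated in one place in Li–Liu 2001, §2–§3: Def. 2.1 (the chambers `SW_{ω,±}`),
  Thm. 2.2 (Taubes: `SW⁰_{ω,−}(L_{K⁻¹}) = 1` when `b⁺ = 1`), Symmetry Lemma 2.3 with the remark
  "`SW⁰₊(L_{K⁻¹} ⊗ K) = ±1`" (p. 339), Thm. 2.7 and Thm. 2.9 (`SW_{ω,−} = Gr` at `b⁺ = 1` under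
  (2.3) `e · E ≥ −1`), Lemma 3.3 (the wall-crossing numbers, from Li–Liu 1995).

DISCHARGE STATUS (review-split seat, 2026-08-17; statements checked against the sources below).
Both facts are apex-sized: a discharge needs the Seiberg–Witten INVARIANT of a closed `4`-manifold
(signed counts of the moduli space: transversality, compactness, orientation; at `b⁺ = 1` the
chamber structure), Taubes's `SW(K⁻¹) = ±1`, the Li–Liu wall-crossing formula and Taubes's
`SW ⇒ Gr` — none of which the tree has (`Literature/Geometry/GaugeTheory` stops at the equations,
the gauge action and the a priori bounds; there is no Gromov invariant).  (C₁) is consumed verbatim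
by `taubes_canonicalClass_symplecticCurve_four_of_split` and by the Summits-side
`stub_taubesCanonicalCurve_of_liLiu`, where `b₂ = 1`, `b₁ = 2`: only the instance `b₁ = 2` of the
wall-crossing formula (one invariant factor `d₁ = (y₁ ⌣ y₂ ⌣ L/2)[M] = 0`; Li–Liu 2001,
Lemma 3.3 (2)) is ever exercised.

SIGN-FREE FORM.  The tree's `AlmostComplexStructure.firstChernClass` is defined through the
topological Chern classes of `CanonicalClass.lean` whose sign convention is not calibrated against
the literature's; the printed theorems give a curve in the class `K_J = −c₁`; the disjunction
`K = K_J ∨ K = c₁(J)` is implied by the printed statement under either calibration, so each fact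
below is the printed theorem or a consequence of it (never stronger).

The two statements are, character for character (up to unfolding the local notations `𝔼 4`,
`ℛ 4` of that file), hypotheses `hC₂` and `hC₁` of
`taubes_canonicalClass_symplecticCurve_four_of_hirzebruchPrinted_of_taubes_upToSign`
(`TaubesCanonicalClassSymplecticCurveFourProofs.lean`), vendored as named facts (promote event
3140251, 2026-08-16: the fact `taubes_canonicalClass_symplecticCurve_four` is PROVED on the tree
modulo exactly these two inputs and Hirzebruch's `c₁² = 2χ + 3σ`,
`hirzebruch_firstChernClass_sq_eq_almostComplex_four`).  Deliberately NOT here: Seiberg–Witten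
invariants, Gromov invariants, the wall-crossing formula, any proof; the assembly
`taubes_canonicalClass_symplecticCurve_four_of_split` lives in
`TaubesCanonicalClassSymplecticCurveFourSplit.lean`.

## References

* C. H. Taubes, *The Seiberg–Witten and Gromov invariants*, Math. Res. Lett. 2 (1995) 221–238,
  Thm. A (1), §3 (3.2), Prop. 4.2. [Taubes1995]
* C. H. Taubes, *The Seiberg–Witten invariants and symplectic forms*, Math. Res. Lett. 1 (1994)
  809–822, Main Theorem. [Taubes1994]
* C. H. Taubes, *SW ⇒ Gr: from the Seiberg–Witten equations to pseudo-holomorphic curves*,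
  J. Amer. Math. Soc. 9 (1996) 845–918 (reference [T1] of Taubes 1995: the proofs of its Thm. 4.1
  and Prop. 4.2). [Taubes1996]
* T.-J. Li, A. Liu, *General wall crossing formula*, Math. Res. Lett. 2 (1995) 797–810, Thm. 1.2,
  Cor. 1.3 and the remark after Cor. 1.6 (p. 799). [LiLiu1995]
* T.-J. Li, A. Liu, *Symplectic structure on ruled surfaces and a generalized adjunction formula*,
  Math. Res. Lett. 2 (1995) 453–471, §0 (p. 454: Thms. 1 and 4 for `b₂⁺ = 1`). [LiLiu1995Ruled]
* T.-J. Li, A.-K. Liu, *The equivalence between SW and Gr in the case where `b⁺ = 1`*,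
  Int. Math. Res. Not. 1999, no. 7, 335–345, Main Theorem. [LiLiu1999]
* T.-J. Li, A.-K. Liu, *Uniqueness of symplectic canonical class, surface cone and symplectic cone
  of `4`-manifolds with `b⁺ = 1`*, J. Differential Geom. 58 (2001) 331–370, §2.1 Def. 2.1,
  Thm. 2.2, Lemma 2.3 (pp. 338–339), §2.2 Thm. 2.7 (p. 341), §2.3 Thm. 2.9 (p. 342), Lemma 3.3
  (pp. 344–345). [LiLiu2001]
* A.-K. Liu, *Some new applications of general wall crossing formula, Gompf's conjecture and its
  applications*, Math. Res. Lett. 3 (1996) 569–585, Lemma 8 and its proof (p. 575). [Liu1996]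
* D. McDuff, D. Salamon, *Introduction to Symplectic Topology*, 3rd ed., OUP (2017),
  Thm. 13.3.10, Rem. 13.3.7 eq. (13.3.2) and (13.3.7), Rem. 13.3.8, Thm. 13.3.22, Cor. 13.3.23,
  Cor. 13.3.24 (ii). [McDuffSalamon2017]
-/

noncomputable section

namespace Literature.Geometry.Symplectic

open scoped _root_.Manifold ContDiff
open Literature.Geometry.Kaehler (MForm IsSmoothForm IsClosedForm)
open Literature.AlgebraicTopology.SingularHomology

/-- **Taubes 1995, Thm. A (1) (`SW ⇒ Gr` for the canonical class), `b⁺ ≥ 2`, sign-free form.**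
For a closed connected symplectic `4`-manifold `(N, s)` (non-degenerate closed smooth `2`-form `s`)
with symplectic orientation `μ` and `b⁺ ≥ 2`, there is an `s`-compatible almost complex structure
`J` and a Taubes curve in the class `K`, `K = K_J` or `K = c₁(J)` (see the module docstring for the
sign).  Taubes 1995 Thm. A (1) with §3 (3.2), Prop. 4.2; Taubes 1994; Taubes 1996;
McDuff–Salamon 2017 Thm. 13.3.10, Cor. 13.3.23.  Verbatim hypothesis `hC₂` of
`taubes_canonicalClass_symplecticCurve_four_of_hirzebruchPrinted_of_taubes_upToSign`.
[cite: Taubes1995, Thm. A (1), §3 (3.2), Prop. 4.2] -/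
def taubes1995_hasTaubesCurve_canonicalClass_of_two_le_bPlus : Prop :=
  ∀ (N : Type) [TopologicalSpace N] [T2Space N] [SecondCountableTopology N]
    [CompactSpace N] [ConnectedSpace N] [ChartedSpace (EuclideanSpace ℝ (Fin 4)) N]
    [IsManifold (𝓡 4) ∞ N]
    (s : MForm (𝓡 4) N ℝ 2) (hs : IsSmoothForm s) (hcl : IsClosedForm s)
    (_ : ∀ x (v : TangentSpace (𝓡 4) x), v ≠ 0 → ∃ w : TangentSpace (𝓡 4) x, s x ![v, w] ≠ 0)
    (μ : HomologicalOrientation ℤ N 4), μ.IsSymplecticOrientationOf s hs hcl →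
    2 ≤ sigPos (intersectionForm two_add_two_eq_four μ).toQuadraticMap →
    ∃ J : AlmostComplexStructure (𝓡 4) ∞ N, J.IsCompatibleWith s ∧
      ∃ K : singularCohomology ℤ ℤ N 2, (K = J.canonicalClass ∨ K = J.firstChernClass) ∧
        HasTaubesCurve s hs hcl μ K K

/-- **Li–Liu (`SW ⇒ Gr` for the canonical class when `b⁺ = 1`), sign-free form.**  For a closed
connected symplectic `4`-manifold `(N, s)` with symplectic orientation `μ`, `b⁺ = 1`, `b₁ ≥ 1` and
vanishing rational cup product `H¹ ⊗ H¹ → H²`, there is an `s`-compatible `J` and a Taubes curve in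
the class `K`, `K = K_J` or `K = c₁(J)`.  A corollary of four printed theorems (module docstring,
(C₁)): under these hypotheses every wall-crossing number vanishes (Li–Liu 1995, general
wall-crossing formula, Thm. 1.2 / Cor. 1.3: the jump of `SW(L)` across the wall is `± ∏ dᵢ` for the
invariant factors `dᵢ` of the skew form `(yᵢ yⱼ L / 2)[M]` on `H¹(M; ℤ)/T`, and the remark after
Cor. 1.6, p. 799: "the wall crossing number is zero for all line bundles" once some
`y ∈ H¹(M; ℝ)` annihilates `H¹(M; ℝ)` by cup product), so Taubes's `SW(K⁻¹) = ±1` (Taubes 1994,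
Main Theorem; valid for `b⁺ = 1` in Taubes's chamber, Li–Liu 1995, ruled surfaces, §0 p. 454) and
charge conjugation give `SW(K) = ±1` in Taubes's chamber, whence `SW ⇒ Gr` for `b⁺ = 1` (Li–Liu
1999, Main Theorem = McDuff–Salamon 2017 Thm. 13.3.22, its condition (13.3.23) being automatic
for `A = K` since `K · E = -1` on symplectic `(-1)`-spheres; Cor. 13.3.23) represents `K` by an
embedded symplectic curve.  The deduction is printed in Liu 1996, proof of Lemma 8 (p. 575): "the
wall crossing number calculated by the general wall crossing formula is in fact zero for all
spinᶜ structures … for both `K` and `K⁻¹`, their `SW` invariants, no matter in which chamber, are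
both `±1` … the class `c₁(K)` can be represented by a symplectic curve".
Verbatim hypothesis `hC₁` of
`taubes_canonicalClass_symplecticCurve_four_of_hirzebruchPrinted_of_taubes_upToSign`.
[cite: LiLiu1999, Main Theorem] [cite: Liu1996, Lemma 8, proof (p. 575)]
[cite: LiLiu1995, Thm. 1.2, Cor. 1.3 and the remark after Cor. 1.6 (p. 799)]
[cite: LiLiu1995Ruled, §0 (p. 454)] [cite: LiLiu2001, Thm. 2.2, Lemma 2.3 (p. 339), Thm. 2.9, Lemma 3.3]
[cite: McDuffSalamon2017, Thm. 13.3.10 (b⁺ = 1 clause), Rem. 13.3.7 eq. (13.3.7) and eq. (13.3.2), Thm. 13.3.22, Cor. 13.3.23] -/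
def liLiu1995_hasTaubesCurve_canonicalClass_of_bPlus_eq_one : Prop :=
  ∀ (N : Type) [TopologicalSpace N] [T2Space N] [SecondCountableTopology N]
    [CompactSpace N] [ConnectedSpace N] [ChartedSpace (EuclideanSpace ℝ (Fin 4)) N]
    [IsManifold (𝓡 4) ∞ N]
    (s : MForm (𝓡 4) N ℝ 2) (hs : IsSmoothForm s) (hcl : IsClosedForm s)
    (_ : ∀ x (v : TangentSpace (𝓡 4) x), v ≠ 0 → ∃ w : TangentSpace (𝓡 4) x, s x ![v, w] ≠ 0)
    (μ : HomologicalOrientation ℤ N 4), μ.IsSymplecticOrientationOf s hs hcl →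
    sigPos (intersectionForm two_add_two_eq_four μ).toQuadraticMap = 1 →
    1 ≤ Module.finrank ℤ ↥(singularHomology ℤ ℤ N 1) →
    (∀ a b : ↥(singularCohomology ℚ ℚ N 1), cupProduct one_add_one_eq_two a b = 0) →
    ∃ J : AlmostComplexStructure (𝓡 4) ∞ N, J.IsCompatibleWith s ∧
      ∃ K : singularCohomology ℤ ℤ N 2, (K = J.canonicalClass ∨ K = J.firstChernClass) ∧
        HasTaubesCurve s hs hcl μ K K

end Literature.Geometry.Symplectic

end
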